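import Summits.Ventures.LatticeQCDFlow.TrivializingMaps.FlowTauIntWindowFloor
import Summits.Ventures.LatticeQCDFlow.TrivializingMaps.FlowAutocorrelationAction

/-!
HONEST FRAMING: exact (Metropolis-corrected) sampling algorithms for lattice gauge theory; figures
of merit are autocorrelation/cost numbers at stated couplings and volumes; no continuum-physics
claim.

# FlowTauIntWindowAction — THE Γ-METHOD WINDOW OF THE PLAQUETTE UNDER AN EXACT FLOW SAMPLER:
# `τ_W(S_W) ≥ ½ + W·θ^W`, `θ = max 0 (1 − (2N#plaq)²·C·e^{−mβ²/4}/m)`, `m = e^{−β·2NK(1+4K)}⌊L/2⌋^d v_ρ` —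
# every compact gauge group with `v_ρ > 0`, every `β ≥ 0`, every `L ≥ 2`, every model density `≤ C` over Haar
# (lean-2 GEN-12, ours)

Venture-side (OURS).  Cell `lqcd-flow` (pub-lqcd), unit `pub-lqcd-lean-2-g12`, 2026-08-23.  The composition of
`FlowAutocorrelationAction.wilson_flow_action_autocorr_ge_pow` (all-lag floor for the centred action) with
`FlowTauIntWindowFloor.tauIntWindow_ge_of_pow_le` (a geometric all-lag floor sums to a linear window floor), in
the cell's fitness vocabulary `Scoring.tauIntWindow`:

* **`wilson_flow_action_tauIntWindow_ge`** — `½ + W·θ^W ≤ τ_W(ρ_{S_W})` for every window `W`.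

Reading (no numerics implied): the plaquette's windowed integrated autocorrelation time reported by the
Γ-method for an exact flow sampler whose model is within a factor `C` of the Haar prior grows linearly in the
window up to windows of length `m·e^{mβ²/4}/((2N#plaq)²·C)` — exponentially long in the volume at every fixed
`β > 0`.  NOT CLAIMED: numbers for a trained model; the continuum.  Literature grade: KNOWN MECHANISM, NEW
TYPING; nothing is cited as a fact.
-/

noncomputable section

open MeasureTheory ProbabilityTheory Real Set Filter Finset
open Literature.MathematicalPhysics.QuantumFieldTheory
open Literature.MathematicalPhysics.QuantumFieldTheory.Luscher2010
open Summit.Ventures.LatticeQCDFlow.Exactness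
open Summit.Ventures.LatticeQCDFlow.Scaling
open Summit.Ventures.LatticeQCDFlow.Scoring

namespace Summit.Ventures.LatticeQCDFlow.TrivializingMaps

section Wilson

variable {d L N : ℕ} [NeZero L] {G : Type*} [Group G] [TopologicalSpace G] [IsTopologicalGroup G]
  [CompactSpace G] [MeasurableSpace G] [BorelSpace G] [SecondCountableTopology G]
  (ρ : G →* Matrix (Fin N) (Fin N) ℂ)

/-- **THE PLAQUETTE'S Γ-WINDOW UNDER AN EXACT FLOW SAMPLER** (unitary `ρ`, `d ≥ 2`, `L ≥ 2`, `β ≥ 0`,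
`Var_Haar(Re tr ρ) > 0`, model density `0 < q ≤ C` with `∫ q dD[U] = 1`): for every window `W`,
`½ + W·(max 0 (1 − (2N#plaq)²·C·exp(−mβ²/4)/m))^W ≤ τ_W(ρ_{S_W})`, `m = e^{−β·2NK(1+4K)}⌊L/2⌋^d·Var_Haar(Re tr ρ)`.
[ours] -/
theorem wilson_flow_action_tauIntWindow_ge (hd : 2 ≤ d) (hL : 2 ≤ L) (hρ : Continuous ρ)
    (hρu : ∀ g, ρ g ∈ Matrix.unitaryGroup (Fin N) ℂ)
    (hv : 0 < variance (fun g => (ρ g).trace.re) (haarProbability G)) {β : ℝ} (hβ : 0 ≤ β)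
    {q : GaugeConfig d L G → ℝ} (hqm : Measurable q) (hq0 : ∀ U, 0 < q U) {C : ℝ} (hqC : ∀ U, q U ≤ C)
    (hq1 : ∫ U, q U ∂(trivialMeasure G d L) = 1) (W : ℕ) :
    1 / 2 + W * (max 0 (1 - (2 * N * Fintype.card (Plaquette d L)) ^ 2 *
        (C * exp (-(Real.exp (-(β * (2 * N * ((d + 1) * d ^ 2 : ℕ) * (1 + 4 * ((d + 1) * d ^ 2 : ℕ))))) *
          ((L / 2) ^ d : ℕ) * variance (fun g => (ρ g).trace.re) (haarProbability G) * β ^ 2 / 4))) /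
        (Real.exp (-(β * (2 * N * ((d + 1) * d ^ 2 : ℕ) * (1 + 4 * ((d + 1) * d ^ 2 : ℕ))))) *
          ((L / 2) ^ d : ℕ) * variance (fun g => (ρ g).trace.re) (haarProbability G)))) ^ W ≤
      tauIntWindow (fun n => (∫ U, (wilsonAction ρ U - ∫ V, wilsonAction ρ V ∂(wilsonMeasure (d := d) (L := L) ρ β)) *
          ((imhOp (trivialMeasure G d L)
            (fun U => exp (β * (-wilsonAction ρ U)) / mgf (fun U => -wilsonAction ρ U) (trivialMeasure G d L) β)
            q)^[n] (fun U => wilsonAction ρ U -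
              ∫ V, wilsonAction ρ V ∂(wilsonMeasure (d := d) (L := L) ρ β))) U
          ∂(wilsonMeasure (d := d) (L := L) ρ β)) /
        variance (wilsonAction (d := d) (L := L) ρ) (wilsonMeasure (d := d) (L := L) ρ β)) W := by
  refine tauIntWindow_ge_of_pow_le (le_max_left _ _) (max_le zero_le_one ?_) W fun t _ =>
    wilson_flow_action_autocorr_ge_pow ρ hd hL hρ hρu hv hβ hqm hq0 hqC hq1 t
  have hC : 0 ≤ C := (hq0 (Classical.arbitrary _)).le.trans (hqC _)
  have hm : 0 ≤ Real.exp (-(β * (2 * N * ((d + 1) * d ^ 2 : ℕ) * (1 + 4 * ((d + 1) * d ^ 2 : ℕ))))) *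
      ((L / 2) ^ d : ℕ) * variance (fun g => (ρ g).trace.re) (haarProbability G) :=
    mul_nonneg (mul_nonneg (exp_pos _).le (Nat.cast_nonneg _)) hv.le
  have : 0 ≤ (2 * (N : ℝ) * Fintype.card (Plaquette d L)) ^ 2 *
      (C * exp (-(Real.exp (-(β * (2 * N * ((d + 1) * d ^ 2 : ℕ) * (1 + 4 * ((d + 1) * d ^ 2 : ℕ))))) *
        ((L / 2) ^ d : ℕ) * variance (fun g => (ρ g).trace.re) (haarProbability G) * β ^ 2 / 4))) /
      (Real.exp (-(β * (2 * N * ((d + 1) * d ^ 2 : ℕ) * (1 + 4 * ((d + 1) * d ^ 2 : ℕ))))) *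
        ((L / 2) ^ d : ℕ) * variance (fun g => (ρ g).trace.re) (haarProbability G)) :=
    div_nonneg (mul_nonneg (sq_nonneg _) (mul_nonneg hC (exp_pos _).le)) hm
  linarith

end Wilson

end Summit.Ventures.LatticeQCDFlow.TrivializingMaps

end
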